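import Summits.Parity.GeneralizedHardyLittlewood.Theorems.FordMaynardNoSieveConst0164NegWitness0164FamiliesHigh
import Summits.Parity.GeneralizedHardyLittlewood.Theorems.FordMaynardNoSieveConst0164NegWitness0164LinnikTwo
import Summits.Parity.GeneralizedHardyLittlewood.Theorems.FordMaynardNoSieveConst0164NegWitness0164LinnikThree

/-!
# Route `FordMaynardNoSieveConst0164`, crux `NegWitness0164` (stmt-Parity-19102), line `birth`,
# stub `stub_tweakNeg0164`: the value at `(1/2, 1/2)` as three double slice integrals

Helper file toward the certificate stub (K. Ford, J. Maynard, *On the theory of prime producing sieves*,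
arXiv:2407.14368, §6.1 (6.3) with `m = 2`; hypothesis (iii) of `stub_tweakNeg0164_of_shape`, the cell's
inequality (F3) "`f(1/2, 1/2) ≥ -1`").  Both components of `(1/2, 1/2)` are `≥ 1 - γ = 1/2` and get fragmented:

* `fragOp_two_eq_sum_sum` — (6.3) at a two-component vector, for bounded measurable data:
  `fragOp γ η g (ξ₀, ξ₁) = ξ₀ξ₁ ∑_{a,k=1}^{N} ∫_{u ∈ Δ_a(ξ₀)} ∫_{v ∈ Δ_k(ξ₁)} 𝟙[u, v ≥ η] w_a(u) w_k(v) g(u, v)`;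
* `fragOp_half_half_eq_0164` — at `(γ, η) = (1/2, 41/250)`, for data supported on `{ξᵢ ≥ 41/250, Σ ξ = 1}` with
  `F₀⁽⁶⁾ = 0`: only `(a, k) ∈ {(2,2), (2,3), (3,2)}` survive (one-piece blocks of `1/2` have weight `0`,
  Lemma 5.5 (a); dimensions `≥ 7` carry no support), so
  `fragOp (1/2) (41/250) F₀ (1/2, 1/2) = (T₂₂ + T₂₃ + T₃₂)/4`;
* `blockWeight_three_eq_neg` — three pieces all of whose pairs are `< 1 - γ`: `w_3(v) = -1/(6 v₀v₁v₂)`; hence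
  (`T23_nonneg_0164`, `T32_nonneg_0164`) the mixed terms are `≥ 0` when `F₀⁽⁵⁾ ≥ 0`, and
  `hhalf_of_T22_0164`: hypothesis (iii) follows from the single bound `T₂₂ ≥ -4` on
  `T₂₂ = ∫_{Δ₂(1/2)}∫_{Δ₂(1/2)} 𝟙 F₀⁽⁴⁾(u, v)/(4 u₀u₁v₀v₁)` (for `F₀⁽⁴⁾ ≥ -1` this is
  `(2 log(84/41))² ≈ 2.06 ≤ 4`, left to the certificate file).

Def-free.  References: [FordMaynard2024PrimeSieves] arXiv:2407.14368, §6.1 (6.3), Lemma 5.5, §8.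
-/

noncomputable section

open Finset MeasureTheory
open scoped Classical
open Literature.Combinatorics.Enumerative
open Literature.NumberTheory.Sieve Literature.NumberTheory.Sieve.FordMaynard

namespace Summit.Parity.GeneralizedHardyLittlewood.FordMaynardNoSieveConst0164NegWitness0164

variable {γ η : ℝ}

/-- The data of dimension `a + k` read on `(u, v)`, `u ∈ ℝ^a` fixed: bounded measurable in `v`. [folklore] -/
theorem measurable_append_data_right (g : VecFn) (hgm : ∀ n, Measurable (g n)) {a : ℕ} (u : Fin a → ℝ)
    (k : ℕ) : Measurable (fun v : Fin k → ℝ => g (a + k) (Fin.append u v)) :=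
  (hgm (a + k)).comp (measurable_append_right u)

/-- **(6.3) at a two-component vector.** For `0 < η`, `g` bounded and measurable in each dimension and
`ξ = (ξ₀, ξ₁)`,
`fragOp γ η g (ξ) = ξ₀ ξ₁ ∑_{a=1}^{N} ∑_{k=1}^{N} ∫_{u ∈ Δ_a(ξ₀)} ∫_{v ∈ Δ_k(ξ₁)} 𝟙[u ≥ η, v ≥ η] w_a(u) w_k(v) g(u, v) dv du`,
`w_n(v) = 𝓛_{1-γ}(v)/(n! ∏ v)`, `N = ⌊1/η⌋`. [cite: FordMaynard2024PrimeSieves, §6.1 (6.3)] -/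
theorem fragOp_two_eq_sum_sum (hη : 0 < η) (g : VecFn) (hgm : ∀ n, Measurable (g n)) {F : ℝ}
    (hF : ∀ n v, |g n v| ≤ F) (ξ : Fin 2 → ℝ) :
    fragOp γ η g 2 ξ = ξ 0 * ξ 1 *
      ∑ a ∈ Finset.Icc 1 (maxBlock η), ∑ k ∈ Finset.Icc 1 (maxBlock η),
        sliceIntegral a (ξ 0) (fun u => sliceIntegral k (ξ 1) (fun v =>
          if (∀ t, η ≤ u t) ∧ (∀ i, η ≤ v i) then
            blockWeight γ a u * blockWeight γ k v * g (a + k) (Fin.append u v) else 0)) := by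
  rw [fragOp_eq_multiSlice hη g hgm hF 2 ξ, Fin.prod_univ_two]
  congr 1
  set S : Finset ℕ := Finset.Icc 1 (maxBlock η) with hS
  -- peel the second block
  set Fs : (Fin 1 → ℕ) → ℕ → ℝ := fun kv' k => multiSlice 1 kv' (Fin.init ξ) (fun β' => sliceIntegral k (ξ 1)
    (fun v => if (∀ t, η ≤ β' t) ∧ (∀ i, η ≤ v i) then
      (∏ j : Fin 1, blockWeight γ (kv' j) (fun i =>
          β' (Fin.cast (bsum_eq_sum 1 kv').symm (finSigmaFinEquiv (n := kv') ⟨j, i⟩)))) *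
        blockWeight γ k v * g (bsum 1 kv' + k) (Fin.append β' v) else 0)) with hFs
  have hpeel : ∀ kv : Fin 2 → ℕ,
      multiSlice 2 kv ξ (fun β => if ∀ t, η ≤ β t then
        (∏ j, blockWeight γ (kv j) (fun i =>
            β (Fin.cast (bsum_eq_sum 2 kv).symm (finSigmaFinEquiv (n := kv) ⟨j, i⟩)))) *
          g (∑ j, kv j) (β ∘ Fin.cast (bsum_eq_sum 2 kv).symm) else 0) =
      Fs (Fin.init kv) (kv (Fin.last 1)) := by
    intro kv
    rw [fragH_peel]
    rfl
  rw [Finset.sum_congr rfl fun kv _ => hpeel kv, sum_piFinset_init_last S Fs, sum_piFinset_fin_one]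
  refine Finset.sum_congr rfl fun a _ => Finset.sum_congr rfl fun k _ => ?_
  -- the first block: `multiSlice` over one block of size `a`
  simp only [hFs]
  rw [multiSlice_one]
  show sliceIntegral a (ξ 0) _ = _
  congr 1
  funext u
  congr 1
  funext v
  have hcond : (∀ t, η ≤ (u ∘ Fin.cast (Nat.zero_add a)) t) ↔ ∀ t, η ≤ u t := by
    constructor
    · intro h t
      have := h (Fin.cast (Nat.zero_add a).symm t)
      simpa using this
    · intro h t
      exact h _
  split_ifs with hc h h
  · rw [Fin.prod_univ_one]
    congr 1
    · congr 1
      refine congrArg (blockWeight γ a) (funext fun i => ?_)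
      simp only [Function.comp_apply]
      congr 1
      ext
      simp only [Fin.val_cast, finSigmaFinEquiv_apply]
      simp
    · refine VecFn.apply_congr g (by simp [bsum]) _ _ fun i => ?_
      refine Fin.addCases (fun l => ?_) (fun r => ?_) i
      · rw [Fin.append_left]
        exact (append_apply_eq_left_of_val u v _ (Fin.cast (by simp [bsum]) l) (by simp)).symm
      · rw [Fin.append_right]
        exact (append_apply_eq_right_of_val u v _ r (by simp [bsum])).symm
  · exact absurd ⟨hcond.1 hc.1, hc.2⟩ h
  · exact absurd ⟨hcond.2 h.1, h.2⟩ hc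
  · rfl

/-- A slice integral of a function that is nonnegative on the slice is nonnegative. [folklore] -/
theorem sliceIntegral_nonneg_of (d : ℕ) (w : ℝ) (G : (Fin d → ℝ) → ℝ)
    (h : ∀ v : Fin d → ℝ, (∀ i, 0 < v i) → ∑ i, v i = w → 0 ≤ G v) : 0 ≤ sliceIntegral d w G := by
  cases d with
  | zero => exact le_rfl
  | succ d =>
    simp only [sliceIntegral]
    refine integral_nonneg fun u => ?_
    simp only
    split_ifs with hc
    · refine h _ (fun i => ?_) ?_
      · refine Fin.lastCases ?_ (fun j => ?_) i
        · rw [Fin.snoc_last]; linarith [hc.2]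
        · rw [Fin.snoc_castSucc]; exact hc.1 j
      · rw [Fin.sum_univ_castSucc]
        simp only [Fin.snoc_castSucc, Fin.snoc_last]
        ring
    · exact le_rfl

/-- **Three pieces all of whose pairs are small**: for `u ∈ ℝ³` with all `uᵢ < 1 - γ ≤ u₀ + u₁ + u₂` and every
pair sum `< 1 - γ`, `𝓛_{1-γ}(u) = 2 - 3 = -1` and `blockWeight γ 3 u = -1/(6 u₀u₁u₂)` (e.g. every
three-piece fragmentation of `1/2` at `γ = 1/2`).
[cite: FordMaynard2024PrimeSieves, §8 ("if k = 3 then 𝓛_{1/2}(u) = 2 − #{i<j : uᵢ+uⱼ < 1/2}")] -/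
theorem blockWeight_three_eq_neg {γ : ℝ} (u : Fin 3 → ℝ) (hlt : ∀ i, u i < 1 - γ)
    (hs : 1 - γ ≤ u 0 + u 1 + u 2) (h01 : u 0 + u 1 < 1 - γ) (h02 : u 0 + u 2 < 1 - γ)
    (h12 : u 1 + u 2 < 1 - γ) : blockWeight γ 3 u = -1 / (6 * (u 0 * u 1 * u 2)) := by
  unfold blockWeight
  rw [linnikFn_three_eq u hlt hs, if_pos h01, if_pos h02, if_pos h12, Fin.prod_univ_three,
    show (Nat.factorial 3 : ℝ) = 6 from by norm_num [Nat.factorial]]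
  norm_num

/-- On the slice `Δ₂(1/2)` the two-piece weight at `γ = 1/2` is `-1/(2 u₀u₁) ≤ 0`.
[cite: FordMaynard2024PrimeSieves, §8 ("if k = 2 then 𝓛_{1/2}(u) = −1")] -/
theorem blockWeight_half_two_nonpos (u : Fin 2 → ℝ) (hpos : ∀ i, 0 < u i) (hs : ∑ i, u i = 1 / 2) :
    blockWeight (1 / 2) 2 u ≤ 0 := by
  rw [Fin.sum_univ_two] at hs
  have h0 := hpos 0
  have h1 := hpos 1
  rw [blockWeight_two_eq u (by linarith) (by linarith) (by linarith)]
  exact div_nonpos_of_nonpos_of_nonneg (by norm_num) (by positivity)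

/-- On the slice `Δ₃(1/2)` the three-piece weight at `γ = 1/2` is `-1/(6 u₀u₁u₂) ≤ 0` (every pair sums to
`1/2 - u_k < 1/2`). [cite: FordMaynard2024PrimeSieves, §8] -/
theorem blockWeight_half_three_nonpos (u : Fin 3 → ℝ) (hpos : ∀ i, 0 < u i) (hs : ∑ i, u i = 1 / 2) :
    blockWeight (1 / 2) 3 u ≤ 0 := by
  rw [Fin.sum_univ_three] at hs
  have h0 := hpos 0
  have h1 := hpos 1
  have h2 := hpos 2
  rw [blockWeight_three_eq_neg u (fun i => by fin_cases i <;> simp <;> linarith) (by linarith) (by linarith)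
    (by linarith) (by linarith)]
  exact div_nonpos_of_nonpos_of_nonneg (by norm_num) (by positivity)

/-- **The vanishing terms at `(1/2, 1/2)`**: for data supported on `{ξᵢ ≥ 41/250, Σ ξ = 1}` with `F₀⁽⁶⁾ = 0`,
the `(a, k)` double slice term of `fragOp (1/2) (41/250) F₀ (1/2, 1/2)` vanishes when `a = 1` or `k = 1` (a
one-piece block `(1/2)` has weight `0`, Lemma 5.5 (a)) or `a + k ≥ 6` (no support).
[cite: FordMaynard2024PrimeSieves, Lemma 5.5 (a) and §6 (remark after Definition 6.2)] -/
theorem T_half_eq_zero_0164 {F₀ : VecFn}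
    (hsupp : ∀ (k : ℕ) (ξ : Fin k → ℝ), F₀ k ξ ≠ 0 → (∀ i, (41 / 250 : ℝ) ≤ ξ i) ∧ ∑ i, ξ i = 1)
    (h6 : ∀ x : Fin 6 → ℝ, F₀ 6 x = 0) (a k : ℕ) (hak : a = 1 ∨ k = 1 ∨ 6 ≤ a + k) :
    sliceIntegral a (1 / 2) (fun u => sliceIntegral k (1 / 2) (fun v =>
      if (∀ t, (41 / 250 : ℝ) ≤ u t) ∧ (∀ i, (41 / 250 : ℝ) ≤ v i) then
        blockWeight (1 / 2) a u * blockWeight (1 / 2) k v * F₀ (a + k) (Fin.append u v) else 0)) = 0 := by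
  by_cases h6' : 6 ≤ a + k
  · have hz : ∀ (u : Fin a → ℝ) (v : Fin k → ℝ), F₀ (a + k) (Fin.append u v) = 0 := by
      intro u v
      by_cases h7 : 7 ≤ a + k
      · exact apply_eq_zero_of_seven_le_0164 hsupp h7 _
      · have h6e : a + k = 6 := by omega
        rw [VecFn.apply_congr F₀ h6e (Fin.append u v) (Fin.append u v ∘ Fin.cast h6e.symm) fun i =>
          congrArg (Fin.append u v) (Fin.ext rfl)]
        exact h6 _
    simp only [hz, mul_zero, ite_self, sliceIntegral_zero]
  · rcases hak with rfl | rfl | h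
    · rw [sliceIntegral_congr (G' := fun _ => 0) (fun u hu hsum => ?_), sliceIntegral_zero]
      rw [Fin.sum_univ_one] at hsum
      have hw : blockWeight (1 / 2) 1 u = 0 :=
        blockWeight_one_eq_zero_of_le u (hu 0).le (by rw [hsum]; norm_num)
      simp only [hw, zero_mul, ite_self, sliceIntegral_zero]
    · refine (sliceIntegral_congr (G' := fun _ => 0) (fun u _ _ => ?_)).trans (sliceIntegral_zero _ _)
      rw [sliceIntegral_congr (G' := fun _ => 0) (fun v hv hsum => ?_), sliceIntegral_zero]
      rw [Fin.sum_univ_one] at hsum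
      have hw : blockWeight (1 / 2) 1 v = 0 :=
        blockWeight_one_eq_zero_of_le v (hv 0).le (by rw [hsum]; norm_num)
      rw [hw, mul_zero, zero_mul, ite_self]
    · exact absurd h h6'

/-- **The value at `(1/2, 1/2)` as three double slice integrals.** For data `F₀` piecewise Lipschitz in each
dimension, supported on `{ξᵢ ≥ 41/250, Σ ξ = 1}`, with `F₀⁽⁶⁾ = 0`:
`fragOp (1/2) (41/250) F₀ (1/2, 1/2) = (T₂₂ + T₂₃ + T₃₂)/4`, where
`T_{a,k} = ∫_{u ∈ Δ_a(1/2)} ∫_{v ∈ Δ_k(1/2)} 𝟙[u, v ≥ 41/250] w_a(u) w_k(v) F₀(u, v)`.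
[cite: FordMaynard2024PrimeSieves, §6.1 (6.3) and §8] -/
theorem fragOp_half_half_eq_0164 {F₀ : VecFn} (hpl : ∀ k, IsPiecewiseLipschitz (F₀ k))
    (hsupp : ∀ (k : ℕ) (ξ : Fin k → ℝ), F₀ k ξ ≠ 0 → (∀ i, (41 / 250 : ℝ) ≤ ξ i) ∧ ∑ i, ξ i = 1)
    (h6 : ∀ x : Fin 6 → ℝ, F₀ 6 x = 0) :
    fragOp (1 / 2) (41 / 250) F₀ 2 (fun _ => 1 / 2) = 1 / 4 *
      (sliceIntegral 2 (1 / 2) (fun u => sliceIntegral 2 (1 / 2) (fun v =>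
          if (∀ t, (41 / 250 : ℝ) ≤ u t) ∧ (∀ i, (41 / 250 : ℝ) ≤ v i) then
            blockWeight (1 / 2) 2 u * blockWeight (1 / 2) 2 v * F₀ (2 + 2) (Fin.append u v) else 0)) +
        sliceIntegral 2 (1 / 2) (fun u => sliceIntegral 3 (1 / 2) (fun v =>
          if (∀ t, (41 / 250 : ℝ) ≤ u t) ∧ (∀ i, (41 / 250 : ℝ) ≤ v i) then
            blockWeight (1 / 2) 2 u * blockWeight (1 / 2) 3 v * F₀ (2 + 3) (Fin.append u v) else 0)) +
        sliceIntegral 3 (1 / 2) (fun u => sliceIntegral 2 (1 / 2) (fun v =>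
          if (∀ t, (41 / 250 : ℝ) ≤ u t) ∧ (∀ i, (41 / 250 : ℝ) ≤ v i) then
            blockWeight (1 / 2) 3 u * blockWeight (1 / 2) 2 v * F₀ (3 + 2) (Fin.append u v) else 0))) := by
  obtain ⟨F, hF⟩ := exists_uniform_bound_of_support (by norm_num) hpl hsupp
  rw [fragOp_two_eq_sum_sum (by norm_num) F₀ (fun n => (hpl n).measurable) hF, maxBlock_0164]
  set T : ℕ → ℕ → ℝ := fun a k => sliceIntegral a (1 / 2) (fun u => sliceIntegral k (1 / 2) (fun v =>
    if (∀ t, (41 / 250 : ℝ) ≤ u t) ∧ (∀ i, (41 / 250 : ℝ) ≤ v i) then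
      blockWeight (1 / 2) a u * blockWeight (1 / 2) k v * F₀ (a + k) (Fin.append u v) else 0)) with hT
  have hT0 : ∀ a k, a = 1 ∨ k = 1 ∨ 6 ≤ a + k → T a k = 0 := T_half_eq_zero_0164 hsupp h6
  show (1 / 2 : ℝ) * (1 / 2) * ∑ a ∈ Finset.Icc 1 6, ∑ k ∈ Finset.Icc 1 6, T a k =
    1 / 4 * (T 2 2 + T 2 3 + T 3 2)
  rw [Finset.sum_eq_add_of_mem 2 3 (by simp) (by simp) (by norm_num) (fun a ha hne => ?_)]
  · rw [Finset.sum_eq_add_of_mem 2 3 (by simp) (by simp) (by norm_num) (fun k hk hne => ?_),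
      Finset.sum_eq_single_of_mem 2 (by simp) (fun k hk h2 => ?_)]
    · ring
    · have := Finset.mem_Icc.1 hk
      exact hT0 3 k (by omega)
    · have := Finset.mem_Icc.1 hk
      have h2 := hne.1
      have h3 := hne.2
      exact hT0 2 k (by omega)
  · have := Finset.mem_Icc.1 ha
    have h2 := hne.1
    have h3 := hne.2
    exact Finset.sum_eq_zero fun k hk => by
      have := Finset.mem_Icc.1 hk
      exact hT0 a k (by omega)

/-- **Hypothesis (iii) of `stub_tweakNeg0164_of_shape` from one bound.** For data `F₀` piecewise Lipschitz
in each dimension, supported on `{ξᵢ ≥ 41/250, Σ ξ = 1}`, with `F₀⁽⁵⁾ ≥ 0` and `F₀⁽⁶⁾ = 0`: the mixed terms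
`T₂₃, T₃₂` are `≥ 0` (both weights are negative on `Δ₂(1/2)`, `Δ₃(1/2)`), so
`fragOp (1/2) (41/250) F₀ (1/2, 1/2) ≥ -1` follows from `T₂₂ ≥ -4`, where
`T₂₂ = ∫_{Δ₂(1/2)} ∫_{Δ₂(1/2)} 𝟙[u, v ≥ 41/250] F₀⁽⁴⁾(u, v)/(4 u₀u₁v₀v₁)` (for `F₀⁽⁴⁾ ≥ -1`:
`T₂₂ ≥ -(2 log(84/41))² ≈ -2.06`). [cite: FordMaynard2024PrimeSieves, §8 (proof of Theorem 2.7 (c))] -/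
theorem hhalf_of_T22_0164 {F₀ : VecFn} (hpl : ∀ k, IsPiecewiseLipschitz (F₀ k))
    (hsupp : ∀ (k : ℕ) (ξ : Fin k → ℝ), F₀ k ξ ≠ 0 → (∀ i, (41 / 250 : ℝ) ≤ ξ i) ∧ ∑ i, ξ i = 1)
    (h5 : ∀ x : Fin 5 → ℝ, 0 ≤ F₀ 5 x) (h6 : ∀ x : Fin 6 → ℝ, F₀ 6 x = 0)
    (hT22 : -4 ≤ sliceIntegral 2 (1 / 2) (fun u => sliceIntegral 2 (1 / 2) (fun v =>
      if (∀ t, (41 / 250 : ℝ) ≤ u t) ∧ (∀ i, (41 / 250 : ℝ) ≤ v i) then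
        blockWeight (1 / 2) 2 u * blockWeight (1 / 2) 2 v * F₀ (2 + 2) (Fin.append u v) else 0))) :
    -1 ≤ fragOp (1 / 2) (41 / 250) F₀ 2 (fun _ => 1 / 2) := by
  rw [fragOp_half_half_eq_0164 hpl hsupp h6]
  have h23 : 0 ≤ sliceIntegral 2 (1 / 2) (fun u => sliceIntegral 3 (1 / 2) (fun v =>
      if (∀ t, (41 / 250 : ℝ) ≤ u t) ∧ (∀ i, (41 / 250 : ℝ) ≤ v i) then
        blockWeight (1 / 2) 2 u * blockWeight (1 / 2) 3 v * F₀ (2 + 3) (Fin.append u v) else 0)) := by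
    refine sliceIntegral_nonneg_of _ _ _ fun u hu hus => sliceIntegral_nonneg_of _ _ _ fun v hv hvs => ?_
    split_ifs
    · exact mul_nonneg (mul_nonneg_of_nonpos_of_nonpos (blockWeight_half_two_nonpos u hu hus)
        (blockWeight_half_three_nonpos v hv hvs)) (h5 _)
    · exact le_rfl
  have h32 : 0 ≤ sliceIntegral 3 (1 / 2) (fun u => sliceIntegral 2 (1 / 2) (fun v =>
      if (∀ t, (41 / 250 : ℝ) ≤ u t) ∧ (∀ i, (41 / 250 : ℝ) ≤ v i) then
        blockWeight (1 / 2) 3 u * blockWeight (1 / 2) 2 v * F₀ (3 + 2) (Fin.append u v) else 0)) := by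
    refine sliceIntegral_nonneg_of _ _ _ fun u hu hus => sliceIntegral_nonneg_of _ _ _ fun v hv hvs => ?_
    split_ifs
    · exact mul_nonneg (mul_nonneg_of_nonpos_of_nonpos (blockWeight_half_three_nonpos u hu hus)
        (blockWeight_half_two_nonpos v hv hvs)) (h5 _)
    · exact le_rfl
  linarith

end Summit.Parity.GeneralizedHardyLittlewood.FordMaynardNoSieveConst0164NegWitness0164

end
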